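import Mathlib
import HarnessLib

/-!
# SoloInformed — the bilinearly blended Coons patch of four `C¹` curves (toolkit for (HT))

File I2b₀ of the (HT) step of the solo-informed programme.  Given four planar curves
`cB, cT, cL, cR : ℝ → ℂ` (bottom, top, left, right) with matching corners
`cB 0 = cL 0`, `cB 1 = cR 0`, `cT 0 = cL 1`, `cT 1 = cR 1`, the **Coons patch**

  `h(s,t) = (1−t)·cB(s) + t·cT(s) + (1−s)·cL(t) + s·cR(t)`
  `         − [(1−s)(1−t)·cB(0) + s(1−t)·cB(1) + (1−s)t·cT(0) + st·cT(1)]`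

restricts to the four curves on the sides of `[0,1]²` (`soloInformedCoons_bottom/top/left/right`),
is an affine combination of curve points, and — the point used for (HT) — if the curves are merely
differentiable, `h` has partial derivatives `∂ₛh`, `∂ₜh` (`soloInformed_hasDerivAt_coons_s/t`)
whose cross derivatives `∂ₜ∂ₛh = ∂ₛ∂ₜh` exist and coincide, both being
`−cB′(s) + cT′(s) − cL′(t) + cR′(t) − [cB(0) − cB(1) − cT(0) + cT(1)]`
(`soloInformed_hasDerivAt_coonsDs_t`, `soloInformed_hasDerivAt_coonsDt_s`): no second derivatives
of the curves occur.  Hence the pull-back `G(h) dh` of a holomorphic form along `h` is closed with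
continuous coefficients having the line derivatives that `soloInformed_kzGreen_line` needs.

References: Coons 1967 (MIT MAC-TR-41); Farin, *Curves and Surfaces for CAGD*, §22.
-/

noncomputable section

namespace Summit.KontsevichZagierPeriods.KontsevichZagierPeriods.Theorems

/-- The bilinear corner correction of the Coons patch. -/
def soloInformedCoonsCorner (cB cT : ℝ → ℂ) (s t : ℝ) : ℂ :=
  ((1 - s) * (1 - t) : ℝ) * cB 0 + (s * (1 - t) : ℝ) * cB 1 + ((1 - s) * t : ℝ) * cT 0 +
    (s * t : ℝ) * cT 1

/-- **The bilinearly blended Coons patch** of four curves (bottom, top, left, right). -/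
def soloInformedCoons (cB cT cL cR : ℝ → ℂ) (s t : ℝ) : ℂ :=
  ((1 - t : ℝ) : ℂ) * cB s + (t : ℂ) * cT s + ((1 - s : ℝ) : ℂ) * cL t + (s : ℂ) * cR t -
    soloInformedCoonsCorner cB cT s t

/-- `∂ₛh`: the partial derivative of the Coons patch in `s`. -/
def soloInformedCoonsDs (cB cT cL cR dB dT : ℝ → ℂ) (s t : ℝ) : ℂ :=
  ((1 - t : ℝ) : ℂ) * dB s + (t : ℂ) * dT s - cL t + cR t -
    (-((1 - t : ℝ) : ℂ) * cB 0 + ((1 - t : ℝ) : ℂ) * cB 1 - (t : ℂ) * cT 0 + (t : ℂ) * cT 1)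

/-- `∂ₜh`: the partial derivative of the Coons patch in `t`. -/
def soloInformedCoonsDt (cB cT dL dR : ℝ → ℂ) (s t : ℝ) : ℂ :=
  -cB s + cT s + ((1 - s : ℝ) : ℂ) * dL t + (s : ℂ) * dR t -
    (-((1 - s : ℝ) : ℂ) * cB 0 - (s : ℂ) * cB 1 + ((1 - s : ℝ) : ℂ) * cT 0 + (s : ℂ) * cT 1)

/-- `∂ₜ∂ₛh = ∂ₛ∂ₜh`: the common mixed partial derivative of the Coons patch. -/
def soloInformedCoonsDst (cB cT dB dT dL dR : ℝ → ℂ) (s t : ℝ) : ℂ :=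
  -dB s + dT s - dL t + dR t - (cB 0 - cB 1 - cT 0 + cT 1)

section Boundary

variable {cB cT cL cR : ℝ → ℂ}

/-- Bottom side: `h(s,0) = cB(s)` (given `cB 0 = cL 0`, `cB 1 = cR 0`). -/
theorem soloInformedCoons_bottom (h00 : cL 0 = cB 0) (h10 : cR 0 = cB 1) (s : ℝ) :
    soloInformedCoons cB cT cL cR s 0 = cB s := by
  simp only [soloInformedCoons, soloInformedCoonsCorner, h00, h10]
  push_cast
  ring

/-- Top side: `h(s,1) = cT(s)` (given `cT 0 = cL 1`, `cT 1 = cR 1`). -/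
theorem soloInformedCoons_top (h01 : cL 1 = cT 0) (h11 : cR 1 = cT 1) (s : ℝ) :
    soloInformedCoons cB cT cL cR s 1 = cT s := by
  simp only [soloInformedCoons, soloInformedCoonsCorner, h01, h11]
  push_cast
  ring

/-- Left side: `h(0,t) = cL(t)`. -/
theorem soloInformedCoons_left (t : ℝ) : soloInformedCoons cB cT cL cR 0 t = cL t := by
  simp only [soloInformedCoons, soloInformedCoonsCorner]
  push_cast
  ring

/-- Right side: `h(1,t) = cR(t)`. -/
theorem soloInformedCoons_right (t : ℝ) : soloInformedCoons cB cT cL cR 1 t = cR t := by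
  simp only [soloInformedCoons, soloInformedCoonsCorner]
  push_cast
  ring

end Boundary

/-! ### Partial derivatives: only first derivatives of the curves occur -/

section Deriv

variable {cB cT cL cR dB dT dL dR : ℝ → ℂ}

/-- `∂ₛh` exists wherever `cB`, `cT` are differentiable (any `t`). -/
theorem soloInformed_hasDerivAt_coons_s {s : ℝ} (t : ℝ) (hB : HasDerivAt cB (dB s) s)
    (hT : HasDerivAt cT (dT s) s) :
    HasDerivAt (fun s => soloInformedCoons cB cT cL cR s t)
      (soloInformedCoonsDs cB cT cL cR dB dT s t) s := by
  have h1 := hB.const_mul ((1 - t : ℝ) : ℂ)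
  have h2 := hT.const_mul (t : ℂ)
  have h3 := ((hasDerivAt_id s).const_sub 1).ofReal_comp.mul_const (cL t)
  have h4 := (hasDerivAt_id s).ofReal_comp.mul_const (cR t)
  have c1 := (((hasDerivAt_id s).const_sub 1).mul_const (1 - t)).ofReal_comp.mul_const (cB 0)
  have c2 := ((hasDerivAt_id s).mul_const (1 - t)).ofReal_comp.mul_const (cB 1)
  have c3 := (((hasDerivAt_id s).const_sub 1).mul_const t).ofReal_comp.mul_const (cT 0)
  have c4 := ((hasDerivAt_id s).mul_const t).ofReal_comp.mul_const (cT 1)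
  have h := (((h1.add h2).add h3).add h4).sub (((c1.add c2).add c3).add c4)
  refine (h.congr_of_eventuallyEq (Filter.Eventually.of_forall fun x => ?_)).congr_deriv ?_
  · simp only [soloInformedCoons, soloInformedCoonsCorner, id, Pi.add_apply, Pi.sub_apply]
  · simp only [soloInformedCoonsDs]
    push_cast
    ring

/-- `∂ₜh` exists wherever `cL`, `cR` are differentiable (any `s`). -/
theorem soloInformed_hasDerivAt_coons_t (s : ℝ) {t : ℝ} (hL : HasDerivAt cL (dL t) t)
    (hR : HasDerivAt cR (dR t) t) :
    HasDerivAt (fun t => soloInformedCoons cB cT cL cR s t)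
      (soloInformedCoonsDt cB cT dL dR s t) t := by
  have h1 := ((hasDerivAt_id t).const_sub 1).ofReal_comp.mul_const (cB s)
  have h2 := (hasDerivAt_id t).ofReal_comp.mul_const (cT s)
  have h3 := hL.const_mul ((1 - s : ℝ) : ℂ)
  have h4 := hR.const_mul (s : ℂ)
  have c1 := (((hasDerivAt_id t).const_sub 1).const_mul (1 - s)).ofReal_comp.mul_const (cB 0)
  have c2 := (((hasDerivAt_id t).const_sub 1).const_mul s).ofReal_comp.mul_const (cB 1)
  have c3 := ((hasDerivAt_id t).const_mul (1 - s)).ofReal_comp.mul_const (cT 0)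
  have c4 := ((hasDerivAt_id t).const_mul s).ofReal_comp.mul_const (cT 1)
  have h := (((h1.add h2).add h3).add h4).sub (((c1.add c2).add c3).add c4)
  refine (h.congr_of_eventuallyEq (Filter.Eventually.of_forall fun x => ?_)).congr_deriv ?_
  · simp only [soloInformedCoons, soloInformedCoonsCorner, id, Pi.add_apply, Pi.sub_apply]
  · simp only [soloInformedCoonsDt]
    push_cast
    ring

/-- **`∂ₜ(∂ₛh)` exists and equals the common mixed derivative** (needs only `cL′`, `cR′`). -/
theorem soloInformed_hasDerivAt_coonsDs_t (s : ℝ) {t : ℝ} (hL : HasDerivAt cL (dL t) t)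
    (hR : HasDerivAt cR (dR t) t) :
    HasDerivAt (fun t => soloInformedCoonsDs cB cT cL cR dB dT s t)
      (soloInformedCoonsDst cB cT dB dT dL dR s t) t := by
  have h1 := ((hasDerivAt_id t).const_sub 1).ofReal_comp.mul_const (dB s)
  have h2 := (hasDerivAt_id t).ofReal_comp.mul_const (dT s)
  have c1 := ((hasDerivAt_id t).const_sub 1).ofReal_comp.neg.mul_const (cB 0)
  have c2 := ((hasDerivAt_id t).const_sub 1).ofReal_comp.mul_const (cB 1)
  have c3 := (hasDerivAt_id t).ofReal_comp.mul_const (cT 0)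
  have c4 := (hasDerivAt_id t).ofReal_comp.mul_const (cT 1)
  have h := (((h1.add h2).sub hL).add hR).sub (((c1.add c2).sub c3).add c4)
  refine (h.congr_of_eventuallyEq (Filter.Eventually.of_forall fun x => ?_)).congr_deriv ?_
  · simp only [soloInformedCoonsDs, id, Pi.neg_apply, Pi.add_apply, Pi.sub_apply]
  · simp only [soloInformedCoonsDst]
    push_cast
    ring

/-- **`∂ₛ(∂ₜh)` exists and equals the common mixed derivative** (needs only `cB′`, `cT′`). -/
theorem soloInformed_hasDerivAt_coonsDt_s {s : ℝ} (t : ℝ) (hB : HasDerivAt cB (dB s) s)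
    (hT : HasDerivAt cT (dT s) s) :
    HasDerivAt (fun s => soloInformedCoonsDt cB cT dL dR s t)
      (soloInformedCoonsDst cB cT dB dT dL dR s t) s := by
  have h3 := ((hasDerivAt_id s).const_sub 1).ofReal_comp.mul_const (dL t)
  have h4 := (hasDerivAt_id s).ofReal_comp.mul_const (dR t)
  have c1 := ((hasDerivAt_id s).const_sub 1).ofReal_comp.neg.mul_const (cB 0)
  have c2 := (hasDerivAt_id s).ofReal_comp.mul_const (cB 1)
  have c3 := ((hasDerivAt_id s).const_sub 1).ofReal_comp.mul_const (cT 0)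
  have c4 := (hasDerivAt_id s).ofReal_comp.mul_const (cT 1)
  have h := (((hB.neg.add hT).add h3).add h4).sub (((c1.sub c2).add c3).add c4)
  refine (h.congr_of_eventuallyEq (Filter.Eventually.of_forall fun x => ?_)).congr_deriv ?_
  · simp only [soloInformedCoonsDt, id, Pi.neg_apply, Pi.add_apply, Pi.sub_apply]
  · simp only [soloInformedCoonsDst]
    push_cast
    ring

/-- **Closedness of the pulled-back form.**  With `P = G(h)·∂ₛh`, `Q = G(h)·∂ₜh` one has, purely
algebraically, `G′(h)·∂ₜh·∂ₛh + G(h)·∂ₜ∂ₛh = G′(h)·∂ₛh·∂ₜh + G(h)·∂ₛ∂ₜh`. -/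
theorem soloInformed_coons_closed (G G' : ℂ → ℂ) (s t : ℝ) :
    G' (soloInformedCoons cB cT cL cR s t) * soloInformedCoonsDt cB cT dL dR s t *
        soloInformedCoonsDs cB cT cL cR dB dT s t +
      G (soloInformedCoons cB cT cL cR s t) * soloInformedCoonsDst cB cT dB dT dL dR s t =
    G' (soloInformedCoons cB cT cL cR s t) * soloInformedCoonsDs cB cT cL cR dB dT s t *
        soloInformedCoonsDt cB cT dL dR s t +
      G (soloInformedCoons cB cT cL cR s t) * soloInformedCoonsDst cB cT dB dT dL dR s t := by
  ring

end Deriv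

end Summit.KontsevichZagierPeriods.KontsevichZagierPeriods.Theorems
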